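import Literature.AlgebraicGeometry.Motives.GrassmannianChartAffine
import Mathlib.LinearAlgebra.Basis.Defs
import HarnessLib

/-!
# Column coordinates on the standard chart of a sub-frame of a basis: `U_I(A) ≅ (J ∖ I → Aᵏ)`

Topic `Literature/AlgebraicGeometry/Motives`; namespace `Literature.AlgebraicGeometry.Motives`, prefix `Grassmannian.`.  Basis-general
form of `GrassmannianChartMatrix` (which is the case `M = Rⁿ`, `b` the standard basis); cell hodgecm-mathlib key (h4) (author
B-p21 (g15), partner B-p18 (g17)).  THEOREMS ONLY (no definition, instance, notation, `sorry`).

For a FREE module `M` with basis `b : J → M`, a `k`-sub-frame `x = b ∘ I` (`I : Fin k → J` injective) and an `R`-algebra `A`, an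
`R`-linear coordinate map `ψ : M → Aᵏ` normalised by `ψ(b_{I i}) = eᵢ` is freely determined by its remaining columns
`(ψ(b_j))_{j ∉ I}`; composed with ★ `chartEquivCoordMaps` ((C4)) this identifies the `A`-points of the standard chart
`U_I = chart (b ∘ I)` of `G(k, M)` with `(J ∖ I) → Aᵏ`, naturally in `A` — the affine space of dimension `k · #(J ∖ I)`
([EisenbudHarris2016, §3.2.2]: «the `I`-columns are the identity, the other entries are free coordinates»; [Stacks 089T]).  This is
the form design D of the cell consumes (`M` any free abelian group of rank `n` in the universe of the schemes, base ring `ℤ`).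

* `Grassmannian.coordMaps_ext_basis`, `Grassmannian.exists_coordMap_of_columns`;
* **`Grassmannian.bijective_restrictColumns`** — `ψ ↦ (ψ(b_j))_{j ∉ I}` is a bijection `{ψ // ψ(b_{I i}) = eᵢ} ≃ ({j // j ∉ range I} → Aᵏ)`;
* `Grassmannian.restrictColumns_compLeft` — naturality in `A`;
* **`Grassmannian.bijective_chart_columns`** — `U_I(A) = chart (b ∘ I) A → ({j // j ∉ range I} → Aᵏ)`, `N ↦ (coordMap N (b_j))_j`, is a
  bijection.

HC_CM is proved only modulo the 7 printed citations until rung 0 closes; nothing here is about HC.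

## References
* [EisenbudHarris2016] D. Eisenbud, J. Harris, *3264 and All That* (2016), §3.2.2; [StacksProject, Tag 089T]; EGA I (1971) §9.7.4.
-/

set_option autoImplicit false

noncomputable section

universe u v w uJ

open TensorProduct

namespace Literature.AlgebraicGeometry.Motives

namespace Grassmannian

variable {R : Type u} [CommRing R] {M : Type v} [AddCommGroup M] [Module R M] {k : ℕ} {J : Type uJ}
variable {A : Type w} [CommRing A] [Algebra R A] {B : Type w} [CommRing B] [Algebra R B]

/-- Coordinate maps `M → Aᵏ` normalised on the `I`-columns of a basis `b` are determined by their remaining columns.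
[cite: EisenbudHarris2016, §3.2.2] -/
theorem coordMaps_ext_basis (b : Module.Basis J R M) (I : Fin k → J) {ψ ψ' : M →ₗ[R] (Fin k → A)}
    (hψ : ∀ i, ψ (b (I i)) = Pi.single i 1) (hψ' : ∀ i, ψ' (b (I i)) = Pi.single i 1)
    (h : ∀ j, j ∉ Set.range I → ψ (b j) = ψ' (b j)) : ψ = ψ' := by
  refine b.ext fun j => ?_
  by_cases hj : j ∈ Set.range I
  · obtain ⟨i, rfl⟩ := hj
    rw [hψ, hψ']
  · exact h j hj

/-- Every choice of the non-`I` columns is realised by a coordinate map normalised on the `I`-columns of the basis `b`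
(`I` injective): `Basis.constr`. [cite: EisenbudHarris2016, §3.2.2] -/
theorem exists_coordMap_of_columns (b : Module.Basis J R M) (I : Fin k → J) (hI : Function.Injective I)
    (v : {j : J // j ∉ Set.range I} → (Fin k → A)) :
    ∃ ψ : M →ₗ[R] (Fin k → A),
      (∀ i, ψ (b (I i)) = Pi.single i 1) ∧ ∀ (j) (hj : j ∉ Set.range I), ψ (b j) = v ⟨j, hj⟩ := by
  classical
  -- all columns: the identity on the `I`-columns, `v` elsewhere
  let w : J → (Fin k → A) := fun j =>
    if h : ∃ i, I i = j then Pi.single h.choose 1 else v ⟨j, fun hj => h (Set.mem_range.1 hj)⟩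
  refine ⟨b.constr R w, fun i => ?_, fun j hj => ?_⟩
  · rw [Module.Basis.constr_basis]
    have h : ∃ i', I i' = I i := ⟨i, rfl⟩
    change (if h : ∃ i', I i' = I i then Pi.single h.choose 1 else v ⟨I i, fun hj => h (Set.mem_range.1 hj)⟩) = _
    rw [dif_pos h, hI h.choose_spec]
  · rw [Module.Basis.constr_basis]
    have h : ¬ ∃ i, I i = j := fun h => hj (Set.mem_range.2 h)
    change (if h : ∃ i, I i = j then Pi.single h.choose 1 else v ⟨j, fun hj => h (Set.mem_range.1 hj)⟩) = _
    rw [dif_neg h]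

variable (A) in
/-- **`{ψ : M → Aᵏ // ψ(b_{I i}) = eᵢ} ≅ ({j // j ∉ range I} → Aᵏ)`**: restriction to the non-`I` columns of the basis is a bijection
(`I` injective). [cite: EisenbudHarris2016, §3.2.2] [cite: StacksProject, Tag 089T] -/
theorem bijective_restrictColumns (b : Module.Basis J R M) (I : Fin k → J) (hI : Function.Injective I) :
    Function.Bijective
      (fun ψ : {ψ : M →ₗ[R] (Fin k → A) // ∀ i, ψ (b (I i)) = Pi.single i 1} =>
        fun j : {j : J // j ∉ Set.range I} => ψ.1 (b j.1)) := by
  refine ⟨fun ψ ψ' h => Subtype.ext (coordMaps_ext_basis (R := R) (A := A) b I ψ.2 ψ'.2 fun j hj => ?_), fun v => ?_⟩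
  · have h' := congr_fun h ⟨j, hj⟩
    exact h'
  obtain ⟨ψ, hψ, hv⟩ := exists_coordMap_of_columns (R := R) (A := A) b I hI v
  exact ⟨⟨ψ, hψ⟩, funext fun j => hv j.1 j.2⟩

/-- **Naturality in `A`** of the column coordinates: post-composition with `f : A → B` acts entrywise on the columns.
[cite: EisenbudHarris2016, §3.2.2] -/
theorem restrictColumns_compLeft (f : A →ₐ[R] B) (ψ : M →ₗ[R] (Fin k → A)) (m : M) :
    (f.toLinearMap.compLeft (Fin k) ∘ₗ ψ) m = f ∘ ψ m :=
  rfl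

variable (A) in
/-- **`U_I(A) ≅ ({j // j ∉ range I} → Aᵏ)`** for the sub-frame `b ∘ I` of a basis `b` of `M` (`I` injective): the map
`N ↦ (j ↦ coordMap_{b∘I} N (b_j))_{j ∉ I}` from the standard chart to the tuples of free columns is a bijection — ★ `chartEquivCoordMaps`
((C4)) composed with `bijective_restrictColumns`; natural in `A` by ★ `coordMap_map` and `restrictColumns_compLeft`.  For `M` free of
rank `n` this is `U_I ≅ 𝔸^{k(n−k)}` on `A`-points. [cite: EisenbudHarris2016, §3.2.2] [cite: StacksProject, Tag 089T] -/
theorem bijective_chart_columns (b : Module.Basis J R M) (I : Fin k → J) (hI : Function.Injective I) :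
    Function.Bijective
      (fun N : chart R M k (⇑b ∘ I) A => fun j : {j : J // j ∉ Set.range I} => coordMap _ N.1 N.2 (b j.1)) :=
  (bijective_restrictColumns A b I hI).comp (chartEquivCoordMaps R M k (⇑b ∘ I) A).bijective

end Grassmannian

end Literature.AlgebraicGeometry.Motives

end
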